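import Summits.QuantumFields.BalabanUV.T4Continuum.Spine.NE9.DirectPairingCrossover
import Summits.QuantumFields.BalabanUV.T4Continuum.Spine.NE9.DirectPairingUVTail

/-!
# T⁴ programme, spine estimate NE9 — THE EFFECTIVE CROSSOVER: an explicit `(ε, K)` bookkeeping for King's E-bracket through node U4′ and for
# the King route's node U6, by an interpolation inequality in the number `N` of remaining scales kept — census item C44 of cell
# `pub-balaban-gaps`, seat ne9 (gen 13)

Cell `pub-balaban-gaps` (YM blitz G2, seat ne9, unit `pub-balaban-gaps-ne9-g13`; record `run/shared/lean/pub/pub-balaban-gaps/ne/NE9.md` §5 row C44).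
Summits-side bookkeeping over the tree's node-U4′ vocabulary (`T4Crossover`: `Σ_{j+n=K} min(SIZE, RATE_j·Λⁿ)`, `Step.Discrete031`), this seat's C39
(`DirectPairingCrossover`: the King crossover majorant TENDS TO ZERO, by Tannery's theorem — no rate), C41 (`DirectPairingUVTail`: geometric ∕ p-series
tails) and C30 (`DirectPairingCauchy.abs_genFun_sub_lim_le_of_unif`: `|genFun Z K t − genFunLim Z t| ≤ 2·vol·δ_K`).  NO definition; nothing of Bałaban's asserted.

WHY.  Every END of the King (direct-pairing) route typed by this seat (C30–C43) is QUALITATIVE: the E-side hands node U6 «a scale profile `b_j → 0`»,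
the crossover majorant `δ_K → 0` by dominated convergence (`DirectPairingCrossover.tendsto_sum_min_of_profile`), and the continuum statement is
`CauchySeq` + uniform convergence with NO modulus.  Gen 12's handoff left ONE seat-side sentence in prose (C39 note): the interpolation
`Σ_{j+n=K} min(E₁aⁿ, b_jΛⁿ) ≤ E₁a^{N+1}∕(1−a) + sup_{j ≥ K−N} b_j · Σ_{n ≤ N} Λⁿ` for every `N` — «the radius slot has the size branch and needs no rate».
This file types it and reads off what it buys: an EXPLICIT `(ε, K)` dependence of the King route at nodes U4′ and U6 in terms of the printed scalars
(`E₁`, `a = L^{−β}`, `Λ = L⁴`, `R₁`, `b₀`, `κ₀`) and ONE non-printed datum — a decay envelope of the E-side profile `b` (for Bałaban's `E^{(j)}`: tower-NE5's rate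
and the young-coupling moduli, i.e. W1's constants, census C24–C27).  The cell's data sprint labels every number; this is the formula a flow table would cite
for «how many further renormalization steps `K(ε)` the King route needs», at MODEL level (hypothesis shapes only).

ANSWER (kernel, this file).
* §1 `sum_min_le_tail_add_window` — THE INTERPOLATION INEQUALITY (effective Tannery on the antidiagonal): for ANY size family whose `min` with the rate
  branch is dominated for `n ≥ 1` by a summable `c ≥ 0`, any `Λ ≥ 0`, any cut `N`, and any `β ≥ 0` bounding the profile on the recent window `K − N ≤ j ≤ K`:
  `Σ_{j+n=K} min(s, b_jΛⁿ) ≤ Σ_{i ≥ N+1} c_i + β·Σ_{n ≤ N} Λⁿ` (UV part by the size branch, recent part by the rate branch; `sum_filter_lt_le_tsum_shift`).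
* §2 `crossoverE_le_window`: the E-branch `Σ_{j+n=K} min(E₁aⁿ, b_jΛⁿ) ≤ E₁a^{N+1}∕(1−a) + β·Σ_{n≤N}Λⁿ`; `crossoverR_le_window`: the R-branch under the
  lower half of (0.31), tail `Σ_{i ≥ N+1} R₁(b₀ i)^{−κ₀∕2}`; `entropy_le_card_mul`: `Σ_{n≤N}Λⁿ ≤ (N+1)Λ^N` for `Λ ≥ 1`.
* §3 THE `(ε, K)` BOOKKEEPING: `crossoverE_le_of_scales` — if the UV cut `N` has `E₁a^{N+1}∕(1−a) ≤ ε∕2` and the profile is `≤ η` from scale `J` on with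
  `η·Σ_{n≤N}Λⁿ ≤ ε∕2`, then the E-branch is `≤ ε` for EVERY `K ≥ J + N`; `geomTail_le_of_log`: `N + 1 ≥ log((1−a)δ∕E₁)∕log a` is such a cut
  (`Real.pow_le_iff_le_log`); `crossoverE_le_of_log_scales`: the two composed — `K(ε) = N(ε) + J(ε ∕ (2·Σ_{n≤N(ε)}Λⁿ))`,
  `N(ε) = ⌈log((1−a)ε∕(2E₁))∕log a⌉ − 1`, with `J(η)` the profile's own modulus (`b_j ≤ η` for `j ≥ J(η)`).
* §4 `tendstoUniformly_crossoverE_of_envelope`: for a FAMILY of profiles under ONE envelope `B_j → 0` (runs ∕ shapes ∕ backgrounds — C34∕C35's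
  uniformities) the E-branch tends to zero UNIFORMLY over the family, by §3's `ε∕2` argument — C39's END (`DirectPairingCrossover.tendsto_crossoverE_of_profile`,
  dominated convergence, one profile, no uniformity) is the one-member case; the interpolation inequality subsumes it.
* §5 `abs_genFun_sub_lim_le_window` — EFFECTIVE NODE U6 ON THE KING ROUTE: under King's matching shape with the crossover majorant
  (`DirectPairingCrossover.king_U6_of_crossover`'s hypotheses) and `vol ≥ 0`, for every `K`, `N` and window bound `β`:
  `|genFun Z K t − genFunLim Z t| ≤ 2·vol·(E₁a^{N+1}∕(1−a) + Σ_{i≥N+1}R₁(b₀i)^{−κ₀∕2} + 2β·Σ_{n≤N}Λⁿ + w_K)` on `|t| ≤ l₀` — the continuum-limit error of the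
  block observable's generating function after `K` steps, explicit in everything but the profile's envelope and the weight-class term `w_K` (NE7b ∕ U5c).
* §6 TWO-SIDED — both terms of the interpolation are ATTAINED: `window_term_le_crossoverE` (a profile `≡ β` on the recent window with `βΛⁿ ≤ E₁aⁿ` there
  forces `Σ ≥ β·Σ_{n≤N}Λⁿ` — the entropy factor is sharp) and `uvCut_term_le_crossoverE` (a profile VANISHING on the whole recent window but `≥ E₁` on the old
  scales forces `Σ ≥ E₁a^{N+1}` for `Λ ≥ 1` — the UV cut is necessary; with C39's `profile_le_crossover`: no rate beyond the profile's own is ever inherited).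

VERDICT FOR THE ROW (census C44).  The King route is EFFECTIVE up to ONE datum: given the printed scalars, the continuum-limit error after `K` steps is bounded
by the explicit two-scale trade-off `N ↦ E₁a^{N+1}∕(1−a) + β(K−N)·(N+1)Λ^N` (+ the R-tail + `w_K`), where `β(J) = sup_{j ≥ J} b_j` is the decay envelope of the
E-side profile; e.g. a geometric envelope `β(J) ≤ Cθ^J` (the consecutive currency's tower-NE5 rate) gives an exponential rate in `K` (choose `N = ⌊τK⌋` with
`θ^{1−τ}Λ^τ < 1`), a merely qualitative profile gives `K(ε) = N(ε) + J(ε∕(2Σ_{n≤N(ε)}Λⁿ))` and nothing better (§6).  So the ONLY non-explicit input to a RATE for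
the King route's E-side at nodes U4′ → U6 is the profile's modulus = the quantitative young-coupling moduli of ONE renormalization step (C25: Hölder suffices) composed
with tower-NE5 — W1's constants again.  NOTHING new is owed; CLASSIFICATION OF NE9 UNCHANGED: WORK-bound (W1 = the one-step renormalization transformation as a
Lean object; instance 0∕1).

HONEST FRAMING: bookkeeping for rung (B)+1 on ONE FIXED finite four-torus; elementary real analysis (finite sums, geometric and p-series tails, one logarithm) on
hypothesis SHAPES; (2.43)∕(2.44) are Bałaban's printed Theorem 2 of [III], displayed as the SHAPE of a size branch and NOT proved here; (0.31) enters as the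
hypothesis `Step.Discrete031` (cell flag COND-BetaPertH); King's matching shape `hU5` is [King1986] Thm 3.4's organisation for d = 3, NOT in print for Bałaban's
d = 4 procedure; NE9 NOT PRINTED ∕ NOT PROVED; spine PROVED 0∕9 unchanged; every number this file makes explicit is a MODEL-level formula, not a certified
constant of Bałaban's; NOT UV stability, NOT the continuum limit, NOT infinite volume, NOT a mass gap, NOT Clay.  HONEST DEPENDENCY: continuum YM on T⁴ ⇐
BetaPertH ∧ nine spine estimates (0∕9 proved); BetaPertH ⇐ (D1) ∧ (D4) ∧ CAP+tail.

References (TYPES only): [Balaban1988Convergent] = T. Bałaban, Commun. Math. Phys. **119** (1988) 243–285, Thm 2 (2.43)–(2.44) p. 263; [Balaban1987RG1] =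
T. Bałaban, Commun. Math. Phys. **109** (1987) 249–301, (0.31) p. 259; [King1986] = C. King, Commun. Math. Phys. **102** (1986) 649–677, Thm 3.4 (3.9) p. 656,
p. 657.
-/

namespace Summit.QuantumFields.BalabanUV.T4Continuum.NE9.DirectPairingCrossoverEffective

open scoped BigOperators
open Finset Filter Topology
open Literature.MathematicalPhysics.QuantumFieldTheory.Balaban1983to89
open T4CauchySum (genFun genFunLim)
open Summit.QuantumFields.BalabanUV.T4Continuum.NE9.DirectPairingCrossover (tendsto_kingCrossover)
open Summit.QuantumFields.BalabanUV.T4Continuum.NE9.DirectPairingCauchy (abs_genFun_sub_lim_le_of_unif)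
open Summit.QuantumFields.BalabanUV.T4Continuum.NE9.DirectPairingUVTail (uvTail_tendsto)

/-! ## §1 The interpolation inequality (effective Tannery on the antidiagonal) -/

/-- A shifted summable tail dominates every finite block beyond the cut: for `c ≥ 0` summable,
`Σ_{n ≤ K, N < n} c_n ≤ Σ_{i ≥ 0} c_{i+N+1}`. [folklore] -/
theorem sum_filter_lt_le_tsum_shift {c : ℕ → ℝ} (hc0 : ∀ n, 0 ≤ c n) (hcs : Summable c) (N K : ℕ) :
    ∑ n ∈ (range (K + 1)).filter (fun n => N < n), c n ≤ ∑' i, c (i + (N + 1)) := by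
  have hS : (range (K + 1)).filter (fun n => N < n) = Ico (N + 1) (K + 1) := by
    ext n
    simp only [mem_filter, mem_range, mem_Ico]
    omega
  rw [hS, sum_Ico_eq_sum_range]
  have hsh : Summable fun i => c (i + (N + 1)) := (summable_nat_add_iff (N + 1)).mpr hcs
  calc ∑ k ∈ range (K + 1 - (N + 1)), c (N + 1 + k) = ∑ k ∈ range (K + 1 - (N + 1)), c (k + (N + 1)) :=
        sum_congr rfl fun k _ => by rw [add_comm]
    _ ≤ ∑' i, c (i + (N + 1)) := hsh.sum_le_tsum _ fun i _ => hc0 _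

/-- **THE INTERPOLATION INEQUALITY.**  A size family `s K (j, n)` on `j + n = K` whose `min` with the rate branch `b_j·Λⁿ` is dominated for `n ≥ 1` by a
summable `c_n ≥ 0` (the PRINTED one-run sizes), `Λ ≥ 0` arbitrary, a UV cut `N`, and a bound `β ≥ 0` of the profile on the recent window `K − N ≤ j ≤ K`:
`Σ_{j+n=K} min(s, b_jΛⁿ) ≤ Σ_{i≥0} c_{i+N+1} + β·Σ_{n≤N} Λⁿ` — the `n > N` remaining-scale terms by the size branch, the `n ≤ N` terms by the rate branch.
The effective form of `DirectPairingCrossover.tendsto_sum_min_of_profile` (same hypotheses, a bound at each `K` instead of a limit). [folklore] -/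
theorem sum_min_le_tail_add_window {s : ℕ → ℕ × ℕ → ℝ} {c : ℕ → ℝ} {Λ β : ℝ} {b : ℕ → ℝ} {K N : ℕ}
    (hc0 : ∀ n, 0 ≤ c n) (hcs : Summable c)
    (hdom : ∀ p ∈ antidiagonal K, 1 ≤ p.2 → min (s K p) (b p.1 * Λ ^ p.2) ≤ c p.2)
    (hΛ : 0 ≤ Λ) (hβ0 : 0 ≤ β) (hβ : ∀ j, K - N ≤ j → j ≤ K → b j ≤ β) :
    ∑ p ∈ antidiagonal K, min (s K p) (b p.1 * Λ ^ p.2)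
      ≤ (∑' i, c (i + (N + 1))) + β * ∑ n ∈ range (N + 1), Λ ^ n := by
  -- index the antidiagonal by the number `n` of remaining scales
  set u : ℕ × ℕ → ℝ := fun p => min (s K p) (b p.1 * Λ ^ p.2) with hu
  set g : ℕ → ℝ := fun n => u (K - n, n) with hg
  have h1 : ∑ p ∈ antidiagonal K, u p = ∑ n ∈ range (K + 1), g n := by
    rw [← Nat.sum_antidiagonal_swap, Nat.sum_antidiagonal_eq_sum_range_succ_mk]
    refine sum_congr rfl fun n _ => ?_
    simp only [hg, Prod.swap_prod_mk]
  show ∑ p ∈ antidiagonal K, u p ≤ _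
  rw [h1, ← sum_filter_add_sum_filter_not (range (K + 1)) (fun n => N < n) g]
  -- the UV part `n > N`: size branch, summable tail
  have hUV : ∑ n ∈ (range (K + 1)).filter (fun n => N < n), g n ≤ ∑' i, c (i + (N + 1)) := by
    refine (sum_le_sum fun n hn => ?_).trans (sum_filter_lt_le_tsum_shift hc0 hcs N K)
    rw [mem_filter, mem_range] at hn
    have hp : (K - n, n) ∈ antidiagonal K := by
      rw [HasAntidiagonal.mem_antidiagonal]; omega
    simpa only [hg, hu] using hdom (K - n, n) hp (by simpa using (by omega : 1 ≤ n))
  -- the recent part `n ≤ N`: rate branch, window bound times entropy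
  have hIR : ∑ n ∈ (range (K + 1)).filter (fun n => ¬ N < n), g n ≤ β * ∑ n ∈ range (N + 1), Λ ^ n := by
    have hterm : ∀ n ∈ (range (K + 1)).filter (fun n => ¬ N < n), g n ≤ β * Λ ^ n := by
      intro n hn
      rw [mem_filter, mem_range] at hn
      have hle : b (K - n) * Λ ^ n ≤ β * Λ ^ n :=
        mul_le_mul_of_nonneg_right (hβ (K - n) (by omega) (by omega)) (pow_nonneg hΛ n)
      simpa only [hg, hu] using (min_le_right _ _).trans hle
    refine (sum_le_sum hterm).trans ?_
    rw [← mul_sum]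
    refine mul_le_mul_of_nonneg_left ?_ hβ0
    refine sum_le_sum_of_subset_of_nonneg (fun n hn => ?_) fun n _ _ => pow_nonneg hΛ n
    rw [mem_filter, mem_range] at hn
    rw [mem_range]
    omega
  linarith

/-! ## §2 The two printed size branches: closed-form UV tails -/

/-- **E-BRANCH, EFFECTIVE.**  `0 ≤ E₁`, `0 ≤ a < 1` ((2.43): `a = L^{−β}`), `Λ ≥ 0`, a cut `N` and `β ≥ 0` bounding the profile on `K − N ≤ j ≤ K`:
`Σ_{j+n=K} min(E₁aⁿ, b_jΛⁿ) ≤ E₁a^{N+1}∕(1−a) + β·Σ_{n≤N} Λⁿ`.  Effective form of `DirectPairingCrossover.tendsto_crossoverE_of_profile`.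
[cite: Balaban1988Convergent, Thm 2 (2.43) p.263] [folklore] -/
theorem crossoverE_le_window {E₁ a Λ β : ℝ} {b : ℕ → ℝ} {K N : ℕ} (hE₁ : 0 ≤ E₁) (ha0 : 0 ≤ a) (ha1 : a < 1)
    (hΛ : 0 ≤ Λ) (hβ0 : 0 ≤ β) (hβ : ∀ j, K - N ≤ j → j ≤ K → b j ≤ β) :
    ∑ p ∈ antidiagonal K, min (E₁ * a ^ p.2) (b p.1 * Λ ^ p.2)
      ≤ E₁ * a ^ (N + 1) / (1 - a) + β * ∑ n ∈ range (N + 1), Λ ^ n := by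
  have htail : ∑' i : ℕ, E₁ * a ^ (i + (N + 1)) = E₁ * a ^ (N + 1) / (1 - a) := by
    have hre : ∀ i : ℕ, E₁ * a ^ (i + (N + 1)) = E₁ * a ^ (N + 1) * a ^ i := fun i => by
      rw [pow_add]; ring
    simp_rw [hre]
    rw [tsum_mul_left, tsum_geometric_of_lt_one ha0 ha1, div_eq_mul_inv]
  have h := sum_min_le_tail_add_window (s := fun _ p => E₁ * a ^ p.2) (c := fun n => E₁ * a ^ n) (b := b)
    (K := K) (N := N) (fun n => mul_nonneg hE₁ (pow_nonneg ha0 n))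
    ((summable_geometric_of_lt_one ha0 ha1).mul_left E₁) (fun _ _ _ => min_le_left _ _) hΛ hβ0 hβ
  rwa [htail] at h

/-- **R-BRANCH, EFFECTIVE.**  Under the LOWER half of (0.31) (`Step.Discrete031 b₀ β′ K (g K) (gs K)`, `b₀ > 0`), nonnegative couplings, `R₁ ≥ 0`,
`κ₀ > 2`, `Λ ≥ 0`, a cut `N` and a window bound `β ≥ 0`: `Σ_{j+n=K} min(R₁ (gs K j)^{κ₀}, b_jΛⁿ) ≤ Σ_{i≥0} R₁(b₀(i+N+1))^{−κ₀∕2} + β·Σ_{n≤N} Λⁿ`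
(dominating p-series as in `DirectPairingCrossover.tendsto_crossoverR_of_profile`; the tail is `DirectPairingUVTail.uvTailR_le`'s with `K ↦ N`).
[cite: Balaban1988Convergent, Thm 2 (2.44) p.263] [folklore] -/
theorem crossoverR_le_window {b₀ β' R₁ Λ β : ℝ} {κ₀ : ℕ} {g : ℕ → ℝ} {gs : ℕ → ℕ → ℝ} {b : ℕ → ℝ} {K N : ℕ}
    (hb₀ : 0 < b₀) (h031 : ∀ K, Step.Discrete031 b₀ β' K (g K) (gs K)) (hpos : ∀ K k, k ≤ K → 0 ≤ gs K k)
    (hR₁ : 0 ≤ R₁) (hκ : 2 < κ₀) (hΛ : 0 ≤ Λ) (hβ0 : 0 ≤ β) (hβ : ∀ j, K - N ≤ j → j ≤ K → b j ≤ β) :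
    ∑ p ∈ antidiagonal K, min (R₁ * gs K p.1 ^ κ₀) (b p.1 * Λ ^ p.2)
      ≤ (∑' i : ℕ, R₁ * (b₀ * (((i + (N + 1) : ℕ) : ℝ)))⁻¹ ^ ((κ₀ : ℝ) / 2)) + β * ∑ n ∈ range (N + 1), Λ ^ n := by
  refine sum_min_le_tail_add_window (s := fun K p => R₁ * gs K p.1 ^ κ₀)
    (c := fun n => R₁ * (b₀ * (n : ℝ))⁻¹ ^ ((κ₀ : ℝ) / 2)) (b := b) (K := K) (N := N) ?_ ?_ ?_ hΛ hβ0 hβ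
  · intro n
    exact mul_nonneg hR₁ (Real.rpow_nonneg (inv_nonneg.mpr (by positivity)) _)
  · -- `R₁ (b₀ n)^{−κ₀/2} = R₁ b₀^{−κ₀/2} · (n^{κ₀/2})⁻¹`, a convergent p-series
    have hp : 1 < (κ₀ : ℝ) / 2 := by
      have h2 : (2 : ℝ) < κ₀ := by exact_mod_cast hκ
      linarith
    have hs := (Real.summable_nat_rpow_inv.mpr hp).mul_left (R₁ * b₀⁻¹ ^ ((κ₀ : ℝ) / 2))
    refine hs.congr fun n => ?_
    show R₁ * b₀⁻¹ ^ ((κ₀ : ℝ) / 2) * ((n : ℝ) ^ ((κ₀ : ℝ) / 2))⁻¹ = R₁ * (b₀ * (n : ℝ))⁻¹ ^ ((κ₀ : ℝ) / 2)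
    rw [mul_inv, Real.mul_rpow (inv_nonneg.mpr hb₀.le) (inv_nonneg.mpr (Nat.cast_nonneg n)),
      Real.inv_rpow (Nat.cast_nonneg n)]
    ring
  · intro p hp hn
    have hjK : p.1 + p.2 = K := mem_antidiagonal.mp hp
    have hj : p.1 ≤ K := by omega
    have hn' : (0 : ℝ) < (p.2 : ℝ) := by exact_mod_cast hn
    have hD : 0 < b₀ * (p.2 : ℝ) := mul_pos hb₀ hn'
    have hle : b₀ * (p.2 : ℝ) ≤ 1 / gs K p.1 ^ 2 := by
      have h1 := (h031 K p.1 hj).1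
      have hKj : (K : ℝ) - p.1 = p.2 := by
        have : (K : ℝ) = p.1 + p.2 := by rw [← hjK]; push_cast; ring
        linarith
      rw [hKj] at h1
      have h2 : 0 ≤ 1 / g K ^ 2 := div_nonneg zero_le_one (sq_nonneg _)
      linarith
    exact T4Crossover.min_le_of_inv_sq_le hR₁ (hpos K p.1 hj) hD hle _

/-- The entropy factor of the recent window: `Σ_{n≤N} Λⁿ ≤ (N+1)·Λ^N` for `Λ ≥ 1` (`Λ = L⁴`). [folklore] -/
theorem entropy_le_card_mul {Λ : ℝ} (hΛ : 1 ≤ Λ) (N : ℕ) :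
    ∑ n ∈ range (N + 1), Λ ^ n ≤ ((N : ℝ) + 1) * Λ ^ N := by
  have h := Finset.sum_le_card_nsmul (range (N + 1)) (fun n => Λ ^ n) (Λ ^ N) fun n hn =>
    pow_le_pow_right₀ hΛ (Nat.lt_succ_iff.mp (mem_range.mp hn))
  rw [card_range, nsmul_eq_mul] at h
  have hc : (((N + 1 : ℕ) : ℝ)) = (N : ℝ) + 1 := by push_cast; ring
  rwa [hc] at h

/-! ## §3 The `(ε, K)` bookkeeping of the E-branch -/

/-- **THE `(ε, K)` BOOKKEEPING.**  If the UV cut `N` has `E₁a^{N+1}∕(1−a) ≤ ε∕2`, the profile is `≤ η` (`η ≥ 0`) from scale `J` on, and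
`η·Σ_{n≤N}Λⁿ ≤ ε∕2`, then `Σ_{j+n=K} min(E₁aⁿ, b_jΛⁿ) ≤ ε` for EVERY `K ≥ J + N`: `K(ε) = J + N` further steps suffice. [folklore] -/
theorem crossoverE_le_of_scales {E₁ a Λ η ε : ℝ} {b : ℕ → ℝ} {K N J : ℕ} (hE₁ : 0 ≤ E₁) (ha0 : 0 ≤ a) (ha1 : a < 1)
    (hΛ : 0 ≤ Λ) (hη0 : 0 ≤ η) (hJ : ∀ j, J ≤ j → b j ≤ η)
    (hN : E₁ * a ^ (N + 1) / (1 - a) ≤ ε / 2) (hη : η * ∑ n ∈ range (N + 1), Λ ^ n ≤ ε / 2) (hK : J + N ≤ K) :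
    ∑ p ∈ antidiagonal K, min (E₁ * a ^ p.2) (b p.1 * Λ ^ p.2) ≤ ε := by
  have h := crossoverE_le_window (b := b) (K := K) (N := N) hE₁ ha0 ha1 hΛ hη0
    (fun j hj _ => hJ j (by omega))
  linarith

/-- **CHOOSING THE UV CUT.**  For `0 < a < 1`, `0 < E₁`, `0 < δ`: every `N` with `log((1−a)δ∕E₁)∕log a ≤ N + 1` has `E₁a^{N+1}∕(1−a) ≤ δ`
(`Real.pow_le_iff_le_log`; `log a < 0` reverses the inequality) — e.g. `N = ⌈log((1−a)δ∕E₁)∕log a⌉`. [folklore] -/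
theorem geomTail_le_of_log {E₁ a δ : ℝ} {N : ℕ} (hE₁ : 0 < E₁) (ha0 : 0 < a) (ha1 : a < 1) (hδ : 0 < δ)
    (hN : Real.log ((1 - a) * δ / E₁) / Real.log a ≤ (N : ℝ) + 1) :
    E₁ * a ^ (N + 1) / (1 - a) ≤ δ := by
  have h1a : 0 < 1 - a := by linarith
  have hy : 0 < (1 - a) * δ / E₁ := by positivity
  have hlog : Real.log a < 0 := Real.log_neg ha0 ha1
  have hmul : ((N : ℝ) + 1) * Real.log a ≤ Real.log ((1 - a) * δ / E₁) := by
    have h := mul_le_mul_of_nonpos_right hN hlog.le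
    rwa [div_mul_cancel₀ _ hlog.ne] at h
  have hpow : a ^ (N + 1) ≤ (1 - a) * δ / E₁ := by
    rw [Real.pow_le_iff_le_log ha0 hy]
    exact_mod_cast hmul
  rw [div_le_iff₀ h1a]
  calc E₁ * a ^ (N + 1) ≤ E₁ * ((1 - a) * δ / E₁) := mul_le_mul_of_nonneg_left hpow hE₁.le
    _ = δ * (1 - a) := by field_simp

/-- **THE FORMULA `K(ε) = N(ε) + J`.**  `0 < a < 1`, `0 < E₁`, `Λ ≥ 0`, `ε > 0`; UV cut `N + 1 ≥ log((1−a)ε∕(2E₁))∕log a`; IR scale `J` from which the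
profile is `≤ η` (`η ≥ 0`) with `η·Σ_{n≤N}Λⁿ ≤ ε∕2`.  Then the E-branch of the King crossover is `≤ ε` at every `K ≥ J + N` — §3's two lemmas composed;
the only datum not among the printed scalars is the profile's modulus `η ↦ J(η)`. [folklore] -/
theorem crossoverE_le_of_log_scales {E₁ a Λ η ε : ℝ} {b : ℕ → ℝ} {K N J : ℕ} (hE₁ : 0 < E₁) (ha0 : 0 < a) (ha1 : a < 1)
    (hΛ : 0 ≤ Λ) (hε : 0 < ε) (hN : Real.log ((1 - a) * (ε / 2) / E₁) / Real.log a ≤ (N : ℝ) + 1)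
    (hη0 : 0 ≤ η) (hJ : ∀ j, J ≤ j → b j ≤ η) (hη : η * ∑ n ∈ range (N + 1), Λ ^ n ≤ ε / 2) (hK : J + N ≤ K) :
    ∑ p ∈ antidiagonal K, min (E₁ * a ^ p.2) (b p.1 * Λ ^ p.2) ≤ ε :=
  crossoverE_le_of_scales hE₁.le ha0.le ha1 hΛ hη0 hJ (geomTail_le_of_log hE₁ ha0 ha1 (by linarith) hN) hη hK

/-! ## §4 Uniformity over a family of profiles under one envelope -/

/-- **UNIFORM CONVERGENCE UNDER ONE ENVELOPE.**  For a FAMILY of nonnegative profiles `b α` (`α`: runs, shapes, backgrounds, observables …) under ONE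
envelope `B_j → 0` (`b α j ≤ B j`), `0 ≤ E₁`, `0 ≤ a < 1`, `Λ ≥ 0`: the E-branch `Σ_{j+n=K} min(E₁aⁿ, b_α,j Λⁿ)` tends to zero UNIFORMLY in `α` — first the
UV cut `N` (geometric tail `≤ ε∕4`, `DirectPairingUVTail.uvTail_tendsto`), then the IR scale `J` (`B_j ≤ ε∕(4(Σ_{n≤N}Λⁿ + 1))` for `j ≥ J`), then `K ≥ J + N`
for every member at once (§3).  C39's `DirectPairingCrossover.tendsto_crossoverE_of_profile` is the one-member case, proved there by dominated convergence,
which gives no uniformity; the interpolation inequality does. [folklore] -/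
theorem tendstoUniformly_crossoverE_of_envelope {ι : Type*} {E₁ a Λ : ℝ} {B : ℕ → ℝ} {b : ι → ℕ → ℝ}
    (hE₁ : 0 ≤ E₁) (ha0 : 0 ≤ a) (ha1 : a < 1) (hΛ : 0 ≤ Λ)
    (hb0 : ∀ α j, 0 ≤ b α j) (hbB : ∀ α j, b α j ≤ B j) (hB : Tendsto B atTop (𝓝 0)) :
    TendstoUniformly (fun K α => ∑ p ∈ antidiagonal K, min (E₁ * a ^ p.2) (b α p.1 * Λ ^ p.2))
      (fun _ => 0) atTop := by
  have hnn : ∀ K α, 0 ≤ ∑ p ∈ antidiagonal K, min (E₁ * a ^ p.2) (b α p.1 * Λ ^ p.2) := fun K α =>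
    sum_nonneg fun p _ => le_min (mul_nonneg hE₁ (pow_nonneg ha0 _)) (mul_nonneg (hb0 _ _) (pow_nonneg hΛ _))
  rw [Metric.tendstoUniformly_iff]
  intro ε hε
  -- UV cut
  obtain ⟨N, hN⟩ := (Metric.tendsto_atTop.mp (uvTail_tendsto (E₁ := E₁) ha0 ha1)) (ε / 4) (by linarith)
  have hN' : E₁ * a ^ (N + 1) / (1 - a) ≤ ε / 2 / 2 := by
    have h := hN N le_rfl
    rw [Real.dist_eq, sub_zero] at h
    linarith [le_abs_self (E₁ * a ^ (N + 1) / (1 - a))]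
  -- IR scale, from the common envelope
  set S : ℝ := ∑ n ∈ range (N + 1), Λ ^ n with hS
  have hS0 : 0 ≤ S := sum_nonneg fun n _ => pow_nonneg hΛ n
  have hη0 : 0 < ε / (4 * (S + 1)) := by positivity
  obtain ⟨J, hJ⟩ := (Metric.tendsto_atTop.mp hB) (ε / (4 * (S + 1))) hη0
  have hJ' : ∀ α j, J ≤ j → b α j ≤ ε / (4 * (S + 1)) := fun α j hj => by
    have h := hJ j hj
    rw [Real.dist_eq, sub_zero] at h
    exact (hbB α j).trans ((le_abs_self _).trans h.le)
  have hηS : ε / (4 * (S + 1)) * S ≤ ε / 2 / 2 := by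
    have h1 : ε / (4 * (S + 1)) * S ≤ ε / (4 * (S + 1)) * (S + 1) :=
      mul_le_mul_of_nonneg_left (by linarith) hη0.le
    have h2 : ε / (4 * (S + 1)) * (S + 1) = ε / 2 / 2 := by
      field_simp
      ring
    linarith
  filter_upwards [eventually_ge_atTop (J + N)] with K hK α
  rw [Real.dist_eq, zero_sub, abs_neg, abs_of_nonneg (hnn K α)]
  have h := crossoverE_le_of_scales (ε := ε / 2) (b := b α) hE₁ ha0 ha1 hΛ hη0.le (hJ' α) hN' hηS hK
  linarith

/-! ## §5 Effective node U6 on the King route -/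

/-- **EFFECTIVE NODE U6 ON THE KING ROUTE.**  Under King's matching shape — for all `K`, `n`, a `t`-free constant `c` with
`|log Z_{K+n}(t) − log Z_K(t) − c| ≤ vol·(E-branch + R-branch + w_K)` on `|t| ≤ l₀` (`DirectPairingCrossover.king_U6_of_crossover`'s hypotheses; the limit
`genFunLim` exists by that END) — with `vol ≥ 0`, for EVERY `K`, every UV cut `N` and every `β ≥ 0` bounding the profile on `K − N ≤ j ≤ K`:
`|genFun Z K t − genFunLim Z t| ≤ 2·vol·(E₁a^{N+1}∕(1−a) + Σ_{i≥0}R₁(b₀(i+N+1))^{−κ₀∕2} + 2β·Σ_{n≤N}Λⁿ + w_K)` on the `l₀`-ball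
(`DirectPairingCauchy.abs_genFun_sub_lim_le_of_unif` + §2).  The continuum-limit error after `K` steps, explicit in the printed scalars, the profile's window
bound and the weight-class term.  CONDITIONAL kernel theorem; no hypothesis is in print for Bałaban's d = 4 procedure. [cite: King1986, p.657] [folklore] -/
theorem abs_genFun_sub_lim_le_window {E₁ a Λ b₀ β' R₁ vol l₀ β : ℝ} {κ₀ : ℕ} {g : ℕ → ℝ} {gs : ℕ → ℕ → ℝ}
    {b w : ℕ → ℝ} {Z : ℕ → ℝ → ℝ} (hE₁ : 0 ≤ E₁) (ha0 : 0 ≤ a) (ha1 : a < 1) (hΛ : 0 ≤ Λ)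
    (hb₀ : 0 < b₀) (h031 : ∀ K, Step.Discrete031 b₀ β' K (g K) (gs K)) (hpos : ∀ K k, k ≤ K → 0 ≤ gs K k)
    (hR₁ : 0 ≤ R₁) (hκ : 2 < κ₀) (hb0 : ∀ j, 0 ≤ b j) (hb : Tendsto b atTop (𝓝 0)) (hw : Tendsto w atTop (𝓝 0))
    (hl₀ : 0 ≤ l₀) (hvol : 0 ≤ vol)
    (hU5 : ∀ K n : ℕ, ∃ c : ℝ, ∀ t : ℝ, |t| ≤ l₀ →
      |Real.log (Z (K + n) t) - Real.log (Z K t) - c| ≤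
        vol * ((∑ p ∈ antidiagonal K, min (E₁ * a ^ p.2) (b p.1 * Λ ^ p.2))
          + (∑ p ∈ antidiagonal K, min (R₁ * gs K p.1 ^ κ₀) (b p.1 * Λ ^ p.2)) + w K))
    {K N : ℕ} (hβ0 : 0 ≤ β) (hβ : ∀ j, K - N ≤ j → j ≤ K → b j ≤ β) {t : ℝ} (ht : |t| ≤ l₀) :
    |genFun Z K t - genFunLim Z t| ≤ 2 * (vol * (E₁ * a ^ (N + 1) / (1 - a)
        + (∑' i : ℕ, R₁ * (b₀ * (((i + (N + 1) : ℕ) : ℝ)))⁻¹ ^ ((κ₀ : ℝ) / 2))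
        + 2 * β * (∑ n ∈ range (N + 1), Λ ^ n) + w K)) := by
  have hδ := tendsto_kingCrossover hE₁ ha0 ha1 hΛ hb₀ h031 hpos hR₁ hκ hb0 hb hw
  have h1 := abs_genFun_sub_lim_le_of_unif hU5 hl₀ hδ ht K
  have hE := crossoverE_le_window (b := b) (K := K) (N := N) hE₁ ha0 ha1 hΛ hβ0 hβ
  have hR := crossoverR_le_window (Λ := Λ) (b := b) (K := K) (N := N) hb₀ h031 hpos hR₁ hκ hΛ hβ0 hβ
  refine h1.trans ?_
  have hsum : (∑ p ∈ antidiagonal K, min (E₁ * a ^ p.2) (b p.1 * Λ ^ p.2))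
      + (∑ p ∈ antidiagonal K, min (R₁ * gs K p.1 ^ κ₀) (b p.1 * Λ ^ p.2)) + w K
      ≤ E₁ * a ^ (N + 1) / (1 - a)
        + (∑' i : ℕ, R₁ * (b₀ * (((i + (N + 1) : ℕ) : ℝ)))⁻¹ ^ ((κ₀ : ℝ) / 2))
        + 2 * β * (∑ n ∈ range (N + 1), Λ ^ n) + w K := by
    linarith
  gcongr

/-! ## §6 Two-sided: both terms of the interpolation are attained -/

/-- **THE ENTROPY FACTOR IS SHARP.**  If the profile EQUALS `β` on the recent window `K − N ≤ j ≤ K` (`N ≤ K`, `b ≥ 0`) and the size branch does not bite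
there (`βΛⁿ ≤ E₁aⁿ` for `n ≤ N`, e.g. `E₁ ≥ β(Λ∕a)^N`), then `Σ_{j+n=K} min(E₁aⁿ, b_jΛⁿ) ≥ β·Σ_{n≤N}Λⁿ` — §2's window term exactly. [folklore] -/
theorem window_term_le_crossoverE {E₁ a Λ β : ℝ} {b : ℕ → ℝ} {K N : ℕ} (hE₁ : 0 ≤ E₁) (ha0 : 0 ≤ a) (hΛ : 0 ≤ Λ)
    (hb0 : ∀ j, 0 ≤ b j) (hNK : N ≤ K) (hb : ∀ j, K - N ≤ j → j ≤ K → b j = β)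
    (hbig : ∀ n, n ≤ N → β * Λ ^ n ≤ E₁ * a ^ n) :
    β * ∑ n ∈ range (N + 1), Λ ^ n ≤ ∑ p ∈ antidiagonal K, min (E₁ * a ^ p.2) (b p.1 * Λ ^ p.2) := by
  set u : ℕ × ℕ → ℝ := fun p => min (E₁ * a ^ p.2) (b p.1 * Λ ^ p.2) with hu
  have h1 : ∑ p ∈ antidiagonal K, u p = ∑ n ∈ range (K + 1), u (K - n, n) := by
    rw [← Nat.sum_antidiagonal_swap, Nat.sum_antidiagonal_eq_sum_range_succ_mk]
    refine sum_congr rfl fun n _ => ?_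
    simp only [Prod.swap_prod_mk]
  show _ ≤ ∑ p ∈ antidiagonal K, u p
  rw [h1, mul_sum]
  have hwin : ∀ n ∈ range (N + 1), β * Λ ^ n = u (K - n, n) := by
    intro n hn
    have hn : n ≤ N := Nat.lt_succ_iff.mp (mem_range.mp hn)
    rw [hu]
    simp only
    rw [hb (K - n) (by omega) (by omega), min_eq_right (hbig n hn)]
  rw [sum_congr rfl hwin]
  refine sum_le_sum_of_subset_of_nonneg (fun n hn => ?_) fun n _ _ =>
    le_min (mul_nonneg hE₁ (pow_nonneg ha0 _)) (mul_nonneg (hb0 _) (pow_nonneg hΛ _))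
  rw [mem_range] at hn ⊢
  omega

/-- **THE UV CUT IS NECESSARY.**  A profile that VANISHES on the whole recent window but is `≥ E₁` on the old scales `j + N < K` (`N < K`, `b ≥ 0`, `Λ ≥ 1`,
`0 ≤ a ≤ 1`) still forces `Σ_{j+n=K} min(E₁aⁿ, b_jΛⁿ) ≥ E₁a^{N+1}` — §2's UV term up to the factor `1∕(1−a)`: without a rate on `b` no cut `N` can be
dispensed with, and with C39's `profile_le_crossover` no rate beyond the profile's own is inherited. [folklore] -/
theorem uvCut_term_le_crossoverE {E₁ a Λ : ℝ} {b : ℕ → ℝ} {K N : ℕ} (hE₁ : 0 ≤ E₁) (ha0 : 0 ≤ a) (ha1 : a ≤ 1) (hΛ : 1 ≤ Λ)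
    (hb0 : ∀ j, 0 ≤ b j) (hNK : N < K) (hold : ∀ j, j + N < K → E₁ ≤ b j) :
    E₁ * a ^ (N + 1) ≤ ∑ p ∈ antidiagonal K, min (E₁ * a ^ p.2) (b p.1 * Λ ^ p.2) := by
  have hmem : (K - (N + 1), N + 1) ∈ antidiagonal K := by
    rw [HasAntidiagonal.mem_antidiagonal]; omega
  have hterm : E₁ * a ^ (N + 1) ≤ min (E₁ * a ^ (N + 1)) (b (K - (N + 1)) * Λ ^ (N + 1)) := by
    refine le_min le_rfl ?_
    have h1 : E₁ * a ^ (N + 1) ≤ E₁ * 1 := mul_le_mul_of_nonneg_left (pow_le_one₀ ha0 ha1) hE₁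
    have h2 : E₁ ≤ b (K - (N + 1)) := hold _ (by omega)
    have h3 : b (K - (N + 1)) * 1 ≤ b (K - (N + 1)) * Λ ^ (N + 1) :=
      mul_le_mul_of_nonneg_left (one_le_pow₀ hΛ) (hb0 _)
    linarith
  refine hterm.trans ?_
  exact single_le_sum (f := fun p : ℕ × ℕ => min (E₁ * a ^ p.2) (b p.1 * Λ ^ p.2))
    (fun p _ => le_min (mul_nonneg hE₁ (pow_nonneg ha0 _)) (mul_nonneg (hb0 _) (pow_nonneg (by linarith) _))) hmem

end Summit.QuantumFields.BalabanUV.T4Continuum.NE9.DirectPairingCrossoverEffective
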